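import Mathlib
import HarnessLib
import Summits.Ventures.LatticeQCDFlow.Exactness.FlowPushforward
import Summits.Ventures.LatticeQCDFlow.Exactness.TransformedHMC
import Summits.Ventures.LatticeQCDFlow.Exactness.KickAngleMap

/-!
# The closed-form Jacobian `(1 − κ cos θ')(sin θ / sin θ')^m` of the leading-order kick against the polar law `sin^m θ dθ` (Engel–Schaefer eq. (18)) is an exact `HasJacobian`

HONEST FRAMING: exact (Metropolis-corrected) sampling algorithms for lattice gauge theory;
figures of merit are autocorrelation/cost numbers at stated couplings and volumes; no
continuum-physics claim.

Venture `LatticeQCDFlow` (cell pub-lqcd), topic `Exactness`; FANOUT row 7 (`s0-cpn-null`: the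
S0-D1 rung — 2D CP⁹, Lüscher's LO trivializing map inside HMC, Engel–Schaefer 2011).  NEW WORK of
the cell over Mathlib (one-variable change of variables
`MeasureTheory.lintegral_image_eq_lintegral_abs_deriv_mul`, derivative calculus) and the tree's
`Exactness/FlowPushforward.lean` (`HasJacobian vol F J`: `F_* (J · vol) = vol`, the hypothesis of
`Exactness/TransformedKernel.thmc_exact`) and `Exactness/KickAngleMap.lean` (`kickAngle κ`, its
bijectivity on `[0, π]` for `|κ| ≤ 1`); nothing is cited as a fact.  Printed counterparts, NAMED
ONLY: Engel–Schaefer 2011 §3 eq. (18) (`det 𝒥 = (1 − ε_s c J·x')(cos α − (J·x'/|p|) sin α)^{2N−2}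
= (dθ/dθ')(sin θ/sin θ')^{2N−2}`); Lüscher 2010 §3 (`ln det 𝓕_* = ∫ div Z dt`).

In the polar angle from the local-field axis the single-site LO step is `θ' ↦ kickAngle κ θ' =
θ' − κ sin θ'` with the equatorial direction fixed (`KickAngleMap.lean`, `SphereGeodesicKick.lean`),
and along the axis the uniform law of `S^n` is (a constant times) the POLAR LAW `sin^{n−1}θ dθ` on
`[0, π]` times the uniform law of the equator.  The Jacobian of the site map with respect to the
sphere's own measure is therefore the Jacobian of `kickAngle κ` with respect to `polarLaw m`,
`m = n − 1 = 2N − 2` — the object of this file.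

## Content

* `polarLaw m = sin^m θ · dθ|_{[0,π]}` (`polarLaw_apply`); `kickJac κ m θ' = (1 − κ cos θ') ·
  (sin (kickAngle κ θ') / sin θ')^m` — E–S eq. (18) with `m = 2N − 2`; `kickJac_zero_left` (`= 1`
  at `κ = 0`), **`kickJac_pos`** (`> 0` on `(0, π)` for `|κ| < 1`: the implementation's "Jacobian
  factors > 0" check), `kickJac_nonneg`; `sin_pow_mul_kickJac` (`sin^m θ' · kickJac =
  (1 − κ cos θ') sin^m(kickAngle κ θ')` on `[0, π]`).
* **`hasDerivAt_kickJac_zero`** — at `κ = 0`, `d(kickJac κ m θ)/dκ = −(m + 1) cos θ`: minus the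
  sphere dimension times `cos θ`, the divergence of the kick field (the LO term of `ln det`, in
  closed form).
* **`lintegral_comp_kickAngle`** — the change of variables
  `∫_{[0,π]} g(θ) sin^m θ dθ = ∫_{[0,π]} g(kickAngle κ θ') (1 − κ cos θ') sin^m(kickAngle κ θ') dθ'`
  (`|κ| ≤ 1`, any `g ≥ 0`); `polarLaw_withDensity_kickJac`; **`hasJacobian_kickAngle`** —
  `HasJacobian (polarLaw m) (kickAngle κ) (kickJac κ m)` for `|κ| ≤ 1`, i.e.
  `(kickAngle κ)_* (kickJac · polarLaw m) = polarLaw m`: THE PRINTED PER-SITE FACTOR IS EXACTLY THE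
  DENSITY THAT MAKES THE FIELD-TRANSFORMED UPDATE EXACT; `lintegral_polarLaw_comp_kickAngle` —
  `∫ q d(polarLaw m) = ∫ (q ∘ kickAngle κ) · kickJac d(polarLaw m)` for measurable `q ≥ 0`;
  `hasJacobian_kickAngle_prod` — in axis coordinates `(θ, w) ↦ (kickAngle κ θ, w)` has Jacobian
  `kickJac κ m θ` against `polarLaw m ⊗ σ` for any equator law `σ`.

NOT CLAIMED: the disintegration `uniform(S^n) ≅ c · sin^{n−1}θ dθ ⊗ uniform(S^{n−1})` along an
axis (so the sphere-level `HasJacobian` is not assembled here); several Euler steps / the sweep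
over sites (composition is `HasJacobian.comp` and the tree's coupling-layer lemma
`Theory2.hasJacobian_coupleFun`); anything about autocorrelations.
-/

noncomputable section

namespace Summit.Ventures.LatticeQCDFlow.Exactness

open Real Set MeasureTheory Filter
open scoped ENNReal Topology

/-! ## The polar law and the closed-form Jacobian (E–S eq. (18)) -/

/-- The POLAR LAW with exponent `m`: `sin^m θ dθ` on `[0, π]` (for `m = n − 1` this is, up to a
constant, the law of the angle to a fixed axis under the uniform measure of `S^n`; `n = 2N − 1`,
`m = 2N − 2` for the CP(N−1) site sphere). -/
def polarLaw (m : ℕ) : Measure ℝ :=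
  (volume.restrict (Icc 0 π)).withDensity fun θ => ENNReal.ofReal (sin θ ^ m)

/-- The printed per-site Jacobian, E–S eq. (18), as a function of the start angle:
`kickJac κ m θ' = (1 − κ cos θ') · (sin (kickAngle κ θ') / sin θ')^m` (`= (dθ/dθ')(sin θ/sin θ')^m`). -/
def kickJac (κ : ℝ) (m : ℕ) (θ : ℝ) : ℝ :=
  (1 - κ * cos θ) * (sin (kickAngle κ θ) / sin θ) ^ m

/-- The printed Jacobian is a measurable function of the start angle. -/
theorem measurable_kickJac (κ : ℝ) (m : ℕ) : Measurable (kickJac κ m) := by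
  unfold kickJac
  exact (measurable_const.sub (measurable_const.mul measurable_cos)).mul
    (((measurable_sin.comp (measurable_kickAngle κ)).div measurable_sin).pow_const m)

/-- At `κ = 0` (no kick) the Jacobian is `1` on `(0, π)`. -/
theorem kickJac_zero_left (m : ℕ) {θ : ℝ} (hθ : θ ∈ Ioo 0 π) : kickJac 0 m θ = 1 := by
  have hs : sin θ ≠ 0 := (sin_pos_of_pos_of_lt_pi hθ.1 hθ.2).ne'
  simp [kickJac, div_self hs]

/-- **`kickJac > 0` on `(0, π)` for `|κ| < 1`** (both printed factors positive: the reference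
implementation's "Jacobian factors > 0" exactness check). -/
theorem kickJac_pos {κ : ℝ} (hκ : |κ| < 1) (m : ℕ) {θ : ℝ} (hθ : θ ∈ Ioo 0 π) :
    0 < kickJac κ m θ := by
  have h1 : 0 < 1 - κ * cos θ := one_sub_mul_cos_pos hκ θ
  have hθ' := kickAngle_mem_Ioo hκ.le hθ
  have h2 : 0 < sin (kickAngle κ θ) / sin θ :=
    div_pos (sin_pos_of_pos_of_lt_pi hθ'.1 hθ'.2) (sin_pos_of_pos_of_lt_pi hθ.1 hθ.2)
  exact mul_pos h1 (pow_pos h2 m)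

/-- `kickJac ≥ 0` on `[0, π]` for `|κ| ≤ 1`. -/
theorem kickJac_nonneg {κ : ℝ} (hκ : |κ| ≤ 1) (m : ℕ) {θ : ℝ} (hθ : θ ∈ Icc 0 π) :
    0 ≤ kickJac κ m θ := by
  have h1 : 0 ≤ 1 - κ * cos θ := one_sub_mul_cos_nonneg hκ θ
  have hθ' := kickAngle_mem_Icc hκ hθ
  have h2 : 0 ≤ sin (kickAngle κ θ) / sin θ :=
    div_nonneg (sin_nonneg_of_nonneg_of_le_pi hθ'.1 hθ'.2) (sin_nonneg_of_nonneg_of_le_pi hθ.1 hθ.2)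
  exact mul_nonneg h1 (pow_nonneg h2 m)

/-- The two ways of writing the transported density agree on `[0, π]`:
`sin^m θ' · kickJac κ m θ' = (1 − κ cos θ') · sin^m (kickAngle κ θ')`. -/
theorem sin_pow_mul_kickJac (κ : ℝ) (m : ℕ) {θ : ℝ} (hθ : θ ∈ Icc 0 π) :
    sin θ ^ m * kickJac κ m θ = (1 - κ * cos θ) * sin (kickAngle κ θ) ^ m := by
  unfold kickJac
  by_cases hs : sin θ = 0
  · -- then `θ ∈ {0, π}`, a fixed point, and both sides are `(1 − κ cos θ) · 0^m` resp. equal for `m = 0`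
    have hθ0 : θ = 0 ∨ θ = π := by
      rcases eq_or_lt_of_le hθ.1 with h | h
      · exact Or.inl h.symm
      rcases eq_or_lt_of_le hθ.2 with h' | h'
      · exact Or.inr h'
      exact absurd hs (sin_pos_of_pos_of_lt_pi h h').ne'
    rcases hθ0 with rfl | rfl
    · cases m with
      | zero => simp
      | succ m => simp [kickAngle]
    · cases m with
      | zero => simp
      | succ m => simp [kickAngle]
  · rw [div_pow]
    field_simp

/-- **Leading order in the flow time.**  On `(0, π)`, at `κ = 0`:
`d(kickJac κ m θ)/dκ = −(m + 1) cos θ` — minus the sphere dimension `n = m + 1` times `cos θ`,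
which is (per unit `‖J‖`) the divergence on `S^n` of the kick field `x ↦ J − ⟪J, x⟫ x`, the
spherical gradient of the degree-one harmonic `x ↦ ⟪J, x⟫` whose Laplacian is `−n ⟪J, x⟫`.  So
`log kickJac = −κ n cos θ + O(κ²)`: the first-order term of Lüscher's
`ln det 𝓕_* = ∫ div (generator)`, here in closed form. -/
theorem hasDerivAt_kickJac_zero (m : ℕ) {θ : ℝ} (hθ : θ ∈ Ioo 0 π) :
    HasDerivAt (fun κ => kickJac κ m θ) (-((m : ℝ) + 1) * cos θ) 0 := by
  have hs : sin θ ≠ 0 := (sin_pos_of_pos_of_lt_pi hθ.1 hθ.2).ne'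
  -- the first factor `1 − κ cos θ`
  have h1 := ((hasDerivAt_id' (0 : ℝ)).mul_const (cos θ)).const_sub 1
  -- the ratio `sin (kickAngle κ θ) / sin θ`: equal to `1` at `κ = 0`, derivative `−cos θ`
  have ha : HasDerivAt (fun κ : ℝ => kickAngle κ θ) (-(1 * sin θ)) 0 :=
    ((hasDerivAt_id' (0 : ℝ)).mul_const (sin θ)).const_sub θ
  have h2 := (ha.sin).div_const (sin θ)
  have h3 := h2.pow m
  have h4 := h1.mul h3
  show HasDerivAt (fun κ => (1 - κ * cos θ) * (sin (kickAngle κ θ) / sin θ) ^ m) _ 0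
  refine h4.congr_deriv ?_
  simp only [Pi.pow_apply, kickAngle_zero_left, div_self hs, one_pow, zero_mul, sub_zero, one_mul,
    mul_one]
  field_simp
  ring

/-! ## Change of variables and `HasJacobian` -/

/-- **Change of variables along the kick** (`|κ| ≤ 1`): for every `g : ℝ → ℝ≥0∞`,
`∫_{[0,π]} g(θ) sin^m θ dθ = ∫_{[0,π]} g(kickAngle κ θ') · (1 − κ cos θ') sin^m(kickAngle κ θ') dθ'`
— Mathlib's one-variable change of variables for the injective differentiable map `kickAngle κ` on
`[0, π]`, whose image is `[0, π]` and whose derivative `1 − κ cos θ' ≥ 0` needs no absolute value. -/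
theorem lintegral_comp_kickAngle {κ : ℝ} (hκ : |κ| ≤ 1) (m : ℕ) (g : ℝ → ℝ≥0∞) :
    ∫⁻ θ in Icc 0 π, g θ * ENNReal.ofReal (sin θ ^ m) =
      ∫⁻ θ in Icc 0 π, g (kickAngle κ θ) *
        ENNReal.ofReal ((1 - κ * cos θ) * sin (kickAngle κ θ) ^ m) := by
  have hderiv : ∀ θ ∈ Icc (0 : ℝ) π,
      HasDerivWithinAt (kickAngle κ) (1 - κ * cos θ) (Icc 0 π) θ :=
    fun θ _ => (hasDerivAt_kickAngle κ θ).hasDerivWithinAt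
  have h := lintegral_image_eq_lintegral_abs_deriv_mul measurableSet_Icc hderiv
    (injective_kickAngle hκ).injOn (fun θ => g θ * ENNReal.ofReal (sin θ ^ m))
  rw [image_kickAngle_Icc hκ] at h
  rw [h]
  refine setLIntegral_congr_fun measurableSet_Icc (fun θ _ => ?_)
  have hpos : 0 ≤ 1 - κ * cos θ := one_sub_mul_cos_nonneg hκ θ
  rw [abs_of_nonneg hpos, ENNReal.ofReal_mul hpos]
  ring

/-- The polar law reweighted by the printed Jacobian is Lebesgue measure on `[0, π]` with density
`(1 − κ cos θ') sin^m(kickAngle κ θ')` (the two factors of `sin_pow_mul_kickJac` as densities). -/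
theorem polarLaw_withDensity_kickJac (κ : ℝ) (m : ℕ) :
    (polarLaw m).withDensity (fun θ => ENNReal.ofReal (kickJac κ m θ)) =
      (volume.restrict (Icc 0 π)).withDensity
        fun θ => ENNReal.ofReal ((1 - κ * cos θ) * sin (kickAngle κ θ) ^ m) := by
  have hm1 : Measurable fun θ => ENNReal.ofReal (sin θ ^ m) :=
    ENNReal.measurable_ofReal.comp (measurable_sin.pow_const m)
  have hm2 : Measurable fun θ => ENNReal.ofReal (kickJac κ m θ) :=
    ENNReal.measurable_ofReal.comp (measurable_kickJac κ m)
  rw [polarLaw, ← withDensity_mul _ hm1 hm2]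
  refine withDensity_congr_ae ((ae_restrict_iff' measurableSet_Icc).2 (Eventually.of_forall ?_))
  intro θ hθ
  simp only [Pi.mul_apply]
  have hs : 0 ≤ sin θ ^ m := pow_nonneg (sin_nonneg_of_nonneg_of_le_pi hθ.1 hθ.2) m
  rw [← ENNReal.ofReal_mul hs, sin_pow_mul_kickJac κ m hθ]

/-- The polar law of a set: `polarLaw m s = ∫_{[0,π] ∩ s} sin^m`. -/
theorem polarLaw_apply (m : ℕ) {s : Set ℝ} (hs : MeasurableSet s) :
    polarLaw m s = ∫⁻ θ in Icc 0 π, s.indicator 1 θ * ENNReal.ofReal (sin θ ^ m) := by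
  rw [polarLaw, withDensity_apply _ hs, Measure.restrict_restrict hs,
    ← lintegral_indicator (hs.inter measurableSet_Icc), ← lintegral_indicator measurableSet_Icc]
  refine lintegral_congr (fun θ => ?_)
  by_cases h1 : θ ∈ s <;> by_cases h2 : θ ∈ Icc (0 : ℝ) π <;> simp [indicator, h1, h2]

/-- **The printed per-site factor IS the Jacobian of the kick against the polar law**:
`(kickAngle κ)_* (kickJac κ m · polarLaw m) = polarLaw m` for `|κ| ≤ 1`, i.e.
`HasJacobian (polarLaw m) (kickAngle κ) (kickJac κ m)` in the sense of
`Exactness/FlowPushforward.lean` — the hypothesis under which `TransformedKernel.thmc_exact`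
makes the field-transformed update exact.  (E–S eq. (18) is the case `m = 2N − 2`.) -/
theorem hasJacobian_kickAngle {κ : ℝ} (hκ : |κ| ≤ 1) (m : ℕ) :
    HasJacobian (polarLaw m) (kickAngle κ) fun θ => ENNReal.ofReal (kickJac κ m θ) where
  measurable := measurable_kickAngle κ
  measurable_jac := ENNReal.measurable_ofReal.comp (measurable_kickJac κ m)
  map_eq := by
    rw [polarLaw_withDensity_kickJac κ m]
    ext s hs
    have hpre : MeasurableSet (kickAngle κ ⁻¹' s) := measurable_kickAngle κ hs
    rw [Measure.map_apply (measurable_kickAngle κ) hs, withDensity_apply _ hpre,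
      Measure.restrict_restrict hpre, polarLaw_apply m hs,
      lintegral_comp_kickAngle hκ m (s.indicator 1)]
    rw [← lintegral_indicator (hpre.inter measurableSet_Icc), ← lintegral_indicator measurableSet_Icc]
    refine lintegral_congr (fun θ => ?_)
    by_cases h1 : kickAngle κ θ ∈ s <;> by_cases h2 : θ ∈ Icc (0 : ℝ) π <;>
      simp [indicator, h1, h2]

/-- Integral form of `hasJacobian_kickAngle` for observables: for measurable `q ≥ 0`,
`∫ q d(polarLaw m) = ∫ (q ∘ kickAngle κ) · kickJac κ m d(polarLaw m)` — expectations under the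
polar law are computed in the pre-image variable with the printed Jacobian as weight. -/
theorem lintegral_polarLaw_comp_kickAngle {κ : ℝ} (hκ : |κ| ≤ 1) (m : ℕ) {q : ℝ → ℝ≥0∞}
    (hq : Measurable q) :
    ∫⁻ θ, q θ ∂(polarLaw m) =
      ∫⁻ θ, q (kickAngle κ θ) * ENNReal.ofReal (kickJac κ m θ) ∂(polarLaw m) := by
  have h := hasJacobian_kickAngle hκ m
  conv_lhs => rw [← h.map_eq]
  rw [lintegral_map hq (measurable_kickAngle κ)]
  have h2 := lintegral_withDensity_eq_lintegral_mul (polarLaw m) h.measurable_jac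
    (hq.comp (measurable_kickAngle κ))
  have h3 : (∫⁻ a, q (kickAngle κ a)
        ∂(polarLaw m).withDensity fun θ => ENNReal.ofReal (kickJac κ m θ)) =
      ∫⁻ a, (q ∘ kickAngle κ) a
        ∂(polarLaw m).withDensity fun θ => ENNReal.ofReal (kickJac κ m θ) := rfl
  rw [h3, h2]
  refine lintegral_congr (fun θ => ?_)
  simp only [Pi.mul_apply, Function.comp_apply, mul_comm]

/-- **Axis coordinates: polar angle kicked, equator untouched.**  On `ℝ × W` with the product
law `polarLaw m ⊗ σ` (`W` any "equator" with an s-finite law `σ`), the map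
`(θ, w) ↦ (kickAngle κ θ, w)` — which is the single-site LO update read in axis coordinates
(`SphereGeodesicKick.geodesicKick_meridian`) — has exact Jacobian `kickJac κ m θ`
(`TransformedHMC.HasJacobian.prodMap_id`).  What separates this from the sphere-level statement
is only the identification `uniform(S^n) ≅ c · polarLaw (n−1) ⊗ uniform(S^{n−1})` in axis
coordinates (NOT CLAIMED). -/
theorem hasJacobian_kickAngle_prod {κ : ℝ} (hκ : |κ| ≤ 1) (m : ℕ) {W : Type*} [MeasurableSpace W]
    (σ : Measure W) [SFinite σ] :
    HasJacobian ((polarLaw m).prod σ) (Prod.map (kickAngle κ) id)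
      fun z => ENNReal.ofReal (kickJac κ m z.1) := by
  haveI : SFinite (polarLaw m) := by unfold polarLaw; infer_instance
  exact (hasJacobian_kickAngle hκ m).prodMap_id σ

end Summit.Ventures.LatticeQCDFlow.Exactness

end
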